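import Summits.ResolutionOfSingularities.ResolutionOfSingularities.Theorems.WeightedInvariantWeightedConstructionOffExceptional
import Summits.ResolutionOfSingularities.ResolutionOfSingularities.Theorems.WeightedInvariantIotaOrder
import Summits.ResolutionOfSingularities.ResolutionOfSingularities.Theorems.WeightedInvariantContactCylinderIota
import Mathlib.RingTheory.Localization.Algebra
import HarnessLib

/-!
# OFF THE EXCEPTIONAL DIVISOR THE ORDER IS THE ORDER DOWNSTAIRS: `ord_{B_𝔮}(f) = ord_{S_{𝔮 ∩ S}}(f)` at every prime `𝔮 ∌ t⁻¹` of an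
# extended Rees algebra `B = S[t⁻¹, Iₙ tⁿ]` (door `HypersurfaceCentreConstruction`, stmt-ResolutionOfSingularities-19897)

Helper for `stub_keyRungGrHomLE_three` (def-free, `--supports 19897`): the commutative-algebra kernel of (ISO-OFF) of this hand's
…Iota3CurveFracTieZeroIsolated ((ISO) ⟸ (ISO-OFF)).

* **`Iota3.iotaOrd_atPrime_map_eq_of_isLocalization`** — transport: for a localisation `A → A'` at `M` and a prime `𝔭'` of `A'`,
  `ord_{A'_{𝔭'}}(a) = ord_{A_{𝔭' ∩ A}}(a)` (`A_{𝔭' ∩ A} ≃ A'_{𝔭'}`).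
* **`Iota3.iotaOrd_polynomial_atPrime_eq`** — `ord_{S[X]_𝔮}(f) = ord_{S_{𝔮 ∩ S}}(f)` for EVERY prime `𝔮` of `S[X]` (`S` any commutative
  ring): `S[X]_𝔮 = (S_{𝔮∩S}[X])_{𝔮'}` with `𝔮' ∩ S_{𝔮∩S}` the maximal ideal, and res-type-073's `iotaOrd_torusFactor_eq` (the order of an
  element of a local ring does not change in the local rings of `𝔸¹` over the closed point).
* **`Iota3.iotaOrd_laurent_atPrime_eq`** — the same for `S[t, t⁻¹]` (`= S[X]_X`).
* **`Iota3.iotaOrd_extRees_atPrime_eq_of_tInv_not_mem`** — for `B = extReesAlgebra I` over `S` and a prime `𝔮` of `B` with `t⁻¹ ∉ 𝔮`: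
  `ord_{B_𝔮}(f) = ord_{S_{𝔮 ∩ S}}(f)` for `f ∈ S` (`B[1/t⁻¹] = S[t, t⁻¹]`, Włodarczyk Def. 2.3.5, tree `OffExceptional.isLocalization_away_tInv`).

[OURS · L1 W4.3 · elementary commutative algebra over Mathlib; AI work, weaker than expert review; nothing here is a statement of the
manuscript under review (Hironaka 2017, [claim: Hironaka2017, status: under-review]).]

## References

* J. Włodarczyk, *Functorial resolution by torus actions*, arXiv:2203.03090, Def. 2.3.5 (`B₋ = B ∖ V(t⁻¹) = X × 𝔾ₘ`). [Wlodarczyk2022]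
* M. Nagata, *Local Rings* (1962), §18 (the local ring `S(x)`). [folklore]
-/

noncomputable section

set_option linter.dupNamespace false -- mandated namespace of this single-conjunct summit

open IsLocalRing Polynomial Literature.AlgebraicGeometry.Resolution
open Summit.ResolutionOfSingularities.ResolutionOfSingularities.Theorems
open scoped LaurentPolynomial

namespace Summit.ResolutionOfSingularities.ResolutionOfSingularities.Cruxes.HypersurfaceCentreConstruction.LocalEngine

namespace Iota3

/-! ## §1 Transport along a localisation -/

/-- **`ord_{A'_{𝔭'}}(a) = ord_{A_{𝔭' ∩ A}}(a)`** for a localisation `A → A'` at a submonoid `M` and a prime `𝔭'` of `A'` (the canonical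
isomorphism `A_{𝔭' ∩ A} ≃ A'_{𝔭'}` and (c6) iso-invariance of the order). [folklore] -/
theorem iotaOrd_atPrime_map_eq_of_isLocalization {A A' : Type} [CommRing A] [CommRing A'] [Algebra A A'] (M : Submonoid A)
    [IsLocalization M A'] (𝔭' : Ideal A') [𝔭'.IsPrime] (a : A) :
    iotaOrd (Localization.AtPrime 𝔭') (algebraMap A' (Localization.AtPrime 𝔭') (algebraMap A A' a)) =
      iotaOrd (Localization.AtPrime (𝔭'.comap (algebraMap A A')))
        (algebraMap A (Localization.AtPrime (𝔭'.comap (algebraMap A A'))) a) := by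
  haveI : IsLocalization (𝔭'.comap (algebraMap A A')).primeCompl (Localization.AtPrime 𝔭') :=
    IsLocalization.isLocalization_isLocalization_atPrime_isLocalization M (Localization.AtPrime 𝔭') 𝔭'
  let e : Localization.AtPrime (𝔭'.comap (algebraMap A A')) ≃ₐ[A] Localization.AtPrime 𝔭' :=
    IsLocalization.algEquiv (𝔭'.comap (algebraMap A A')).primeCompl _ _
  have he : e (algebraMap A (Localization.AtPrime (𝔭'.comap (algebraMap A A'))) a) = algebraMap A (Localization.AtPrime 𝔭') a :=
    e.commutes a
  have h6 : iotaOrd (Localization.AtPrime 𝔭') (e (algebraMap A (Localization.AtPrime (𝔭'.comap (algebraMap A A'))) a)) =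
      iotaOrd (Localization.AtPrime (𝔭'.comap (algebraMap A A')))
        (algebraMap A (Localization.AtPrime (𝔭'.comap (algebraMap A A'))) a) :=
    iotaOrd_isoInvariant _ _ e.toRingEquiv _
  rw [← IsScalarTower.algebraMap_apply A A' (Localization.AtPrime 𝔭'), ← he, h6]

/-- `iotaAtPrime iotaOrd` does not depend on the name of the prime (dependent-type bookkeeping). [folklore] -/
theorem iotaOrd_atPrime_congr {A : Type} [CommRing A] {P Q : Ideal A} [P.IsPrime] [Q.IsPrime] (h : P = Q) (a : A) :
    iotaOrd (Localization.AtPrime P) (algebraMap A (Localization.AtPrime P) a) =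
      iotaOrd (Localization.AtPrime Q) (algebraMap A (Localization.AtPrime Q) a) := by
  subst h
  rfl

/-! ## §2 Polynomial and Laurent polynomial rings -/

/-- **`ord_{S[X]_𝔮}(f) = ord_{S_{𝔮 ∩ S}}(f)`** for every commutative ring `S`, every prime `𝔮` of `S[X]` and every `f ∈ S`: localise the base
at `𝔮 ∩ S` (`S[X] → S_{𝔮∩S}[X]` is the localisation at the constants off `𝔮 ∩ S`), then apply res-type-073's `iotaOrd_torusFactor_eq` over the
local base `S_{𝔮∩S}`. [folklore] -/
theorem iotaOrd_polynomial_atPrime_eq {S : Type} [CommRing S] (𝔮 : Ideal S[X]) [𝔮.IsPrime] (f : S) :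
    iotaOrd (Localization.AtPrime 𝔮) (algebraMap S[X] (Localization.AtPrime 𝔮) (C f)) =
      iotaOrd (Localization.AtPrime (𝔮.comap (C : S →+* S[X])))
        (algebraMap S (Localization.AtPrime (𝔮.comap (C : S →+* S[X]))) f) := by
  set 𝔮₀ : Ideal S := 𝔮.comap (C : S →+* S[X]) with h𝔮₀
  letI : Algebra S[X] (Localization.AtPrime 𝔮₀)[X] := Polynomial.algebra S (Localization.AtPrime 𝔮₀)
  haveI : IsLocalization (𝔮₀.primeCompl.map (C : S →+* S[X])) (Localization.AtPrime 𝔮₀)[X] :=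
    Polynomial.isLocalization 𝔮₀.primeCompl (Localization.AtPrime 𝔮₀)
  have halg : ∀ q : S[X], algebraMap S[X] (Localization.AtPrime 𝔮₀)[X] q = q.map (algebraMap S (Localization.AtPrime 𝔮₀)) :=
    fun q => rfl
  -- `𝔮` misses the constants off `𝔮₀`
  have hdisj : Disjoint ((𝔮₀.primeCompl.map (C : S →+* S[X]) : Submonoid S[X]) : Set S[X]) (𝔮 : Set S[X]) := by
    refine Set.disjoint_left.mpr ?_
    rintro _ ⟨s, hs, rfl⟩ hsq
    exact hs hsq
  set 𝔮' : Ideal (Localization.AtPrime 𝔮₀)[X] := 𝔮.map (algebraMap S[X] (Localization.AtPrime 𝔮₀)[X]) with h𝔮'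
  haveI h𝔮'p : 𝔮'.IsPrime := IsLocalization.isPrime_of_isPrime_disjoint (𝔮₀.primeCompl.map (C : S →+* S[X])) _ 𝔮 ‹_› hdisj
  have hcomap : 𝔮'.comap (algebraMap S[X] (Localization.AtPrime 𝔮₀)[X]) = 𝔮 :=
    IsLocalization.under_map_of_isPrime_disjoint (𝔮₀.primeCompl.map (C : S →+* S[X])) _ ‹_› hdisj
  -- transport `S[X]_𝔮 ≃ (S_{𝔮₀}[X])_{𝔮'}`
  have h1 := iotaOrd_atPrime_map_eq_of_isLocalization (𝔮₀.primeCompl.map (C : S →+* S[X])) 𝔮' (C f)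
  rw [iotaOrd_atPrime_congr hcomap] at h1
  rw [← h1, halg, Polynomial.map_C]
  -- over the local base `S_{𝔮₀}` the prime `𝔮'` lies over the closed point
  have hover : 𝔮'.comap (C : Localization.AtPrime 𝔮₀ →+* (Localization.AtPrime 𝔮₀)[X]) = maximalIdeal (Localization.AtPrime 𝔮₀) := by
    refine le_antisymm (IsLocalRing.le_maximalIdeal (Ideal.IsPrime.ne_top (Ideal.IsPrime.comap _))) ?_
    rw [← Localization.AtPrime.map_eq_maximalIdeal, Ideal.map_le_iff_le_comap]
    intro s hs
    rw [Ideal.mem_comap, Ideal.mem_comap, ← Polynomial.map_C (algebraMap S (Localization.AtPrime 𝔮₀)), ← halg]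
    exact Ideal.mem_map_of_mem _ (Ideal.mem_comap.mp hs)
  exact iotaOrd_torusFactor_eq (Localization.AtPrime 𝔮₀) (algebraMap S (Localization.AtPrime 𝔮₀) f) 𝔮' hover

/-- **`ord_{S[t,t⁻¹]_𝔮}(f) = ord_{S_{𝔮 ∩ S}}(f)`** for every prime `𝔮` of the Laurent polynomial ring and `f ∈ S` (`S[t, t⁻¹] = S[X]_X`).
[folklore] -/
theorem iotaOrd_laurent_atPrime_eq {S : Type} [CommRing S] (𝔮 : Ideal S[T;T⁻¹]) [𝔮.IsPrime] (f : S) :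
    iotaOrd (Localization.AtPrime 𝔮) (algebraMap S[T;T⁻¹] (Localization.AtPrime 𝔮) (LaurentPolynomial.C f)) =
      iotaOrd (Localization.AtPrime (𝔮.comap (LaurentPolynomial.C : S →+* S[T;T⁻¹])))
        (algebraMap S (Localization.AtPrime (𝔮.comap (LaurentPolynomial.C : S →+* S[T;T⁻¹]))) f) := by
  have h1 := iotaOrd_atPrime_map_eq_of_isLocalization (Submonoid.powers (X : S[X])) 𝔮 (Polynomial.C f)
  rw [LaurentPolynomial.algebraMap_eq_toLaurent, Polynomial.toLaurent_C] at h1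
  have hce : (algebraMap S[X] S[T;T⁻¹]).comp (Polynomial.C : S →+* S[X]) = (LaurentPolynomial.C : S →+* S[T;T⁻¹]) :=
    RingHom.ext fun s => by rw [RingHom.comp_apply, LaurentPolynomial.algebraMap_eq_toLaurent, Polynomial.toLaurent_C]
  have hcc : (𝔮.comap (algebraMap S[X] S[T;T⁻¹])).comap (Polynomial.C : S →+* S[X]) =
      𝔮.comap (LaurentPolynomial.C : S →+* S[T;T⁻¹]) := by
    rw [Ideal.comap_comap, hce]
  exact h1.trans ((iotaOrd_polynomial_atPrime_eq _ f).trans (iotaOrd_atPrime_congr hcc f))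

/-! ## §3 The extended Rees algebra off `V(t⁻¹)` -/

/-- **OFF THE EXCEPTIONAL DIVISOR THE ORDER IS THE ORDER DOWNSTAIRS**: for `B = extReesAlgebra I` over `S`, a prime `𝔮` of `B` with
`t⁻¹ ∉ 𝔮`, and `f ∈ S`: `ord_{B_𝔮}(f) = ord_{S_{𝔮 ∩ S}}(f)` (`B[1/t⁻¹] = S[t, t⁻¹]`). [cite: Wlodarczyk2022, Def. 2.3.5] -/
theorem iotaOrd_extRees_atPrime_eq_of_tInv_not_mem {S : Type} [CommRing S] (I : ℕ → Ideal S)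
    (𝔮 : Ideal (extReesAlgebra I)) [𝔮.IsPrime] (hT : extReesAlgebra.tInv I ∉ 𝔮) (f : S) :
    iotaOrd (Localization.AtPrime 𝔮) (algebraMap (extReesAlgebra I) (Localization.AtPrime 𝔮) (algebraMap S (extReesAlgebra I) f)) =
      iotaOrd (Localization.AtPrime (𝔮.comap (algebraMap S (extReesAlgebra I))))
        (algebraMap S (Localization.AtPrime (𝔮.comap (algebraMap S (extReesAlgebra I)))) f) := by
  haveI := OffExceptional.isLocalization_away_tInv I
  have hdisj : Disjoint ((Submonoid.powers (extReesAlgebra.tInv I) : Submonoid (extReesAlgebra I)) : Set (extReesAlgebra I))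
      (𝔮 : Set (extReesAlgebra I)) := by
    refine Set.disjoint_left.mpr ?_
    rintro _ ⟨n, rfl⟩ hn
    exact hT (Ideal.IsPrime.mem_of_pow_mem ‹_› n hn)
  set 𝔮' : Ideal S[T;T⁻¹] := 𝔮.map (algebraMap (extReesAlgebra I) S[T;T⁻¹]) with h𝔮'
  haveI : 𝔮'.IsPrime := IsLocalization.isPrime_of_isPrime_disjoint (Submonoid.powers (extReesAlgebra.tInv I)) _ 𝔮 ‹_› hdisj
  have hcomap : 𝔮'.comap (algebraMap (extReesAlgebra I) S[T;T⁻¹]) = 𝔮 :=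
    IsLocalization.under_map_of_isPrime_disjoint (Submonoid.powers (extReesAlgebra.tInv I)) _ ‹_› hdisj
  have h1 := iotaOrd_atPrime_map_eq_of_isLocalization (Submonoid.powers (extReesAlgebra.tInv I)) 𝔮' (algebraMap S (extReesAlgebra I) f)
  rw [iotaOrd_atPrime_congr hcomap] at h1
  have hC : algebraMap (extReesAlgebra I) S[T;T⁻¹] (algebraMap S (extReesAlgebra I) f) = LaurentPolynomial.C f := by
    rw [← IsScalarTower.algebraMap_apply, LaurentPolynomial.algebraMap_apply, Algebra.algebraMap_self, RingHom.id_apply]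
  have hce : (algebraMap (extReesAlgebra I) S[T;T⁻¹]).comp (algebraMap S (extReesAlgebra I)) =
      (LaurentPolynomial.C : S →+* S[T;T⁻¹]) := RingHom.ext fun s => by
    rw [RingHom.comp_apply, ← IsScalarTower.algebraMap_apply, LaurentPolynomial.algebraMap_apply, Algebra.algebraMap_self,
      RingHom.id_apply]
  have hcc : 𝔮'.comap (LaurentPolynomial.C : S →+* S[T;T⁻¹]) = 𝔮.comap (algebraMap S (extReesAlgebra I)) := by
    rw [← hcomap, Ideal.comap_comap, hce]
  rw [hC] at h1
  exact h1.symm.trans ((iotaOrd_laurent_atPrime_eq _ f).trans (iotaOrd_atPrime_congr hcc f))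

end Iota3

end Summit.ResolutionOfSingularities.ResolutionOfSingularities.Cruxes.HypersurfaceCentreConstruction.LocalEngine

end
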